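import Summits.QuantumFields.BalabanUV.T4Continuum.Spine.NE3.PairLandauB8EndSfClassHP
import Summits.QuantumFields.BalabanUV.T4Continuum.Spine.NE3.PairFrameCondition
import HarnessLib

/-!
# T⁴ programme, node NE3 — census R49 (b): THE END OF RECORD WITH (1.37) DISPLAYED AS THE FRAME CONDITION — NE3's local half over Bałaban's class
# ⇐ «[B8] Thm 2's body `LandauRepB8` at every pair ∧ `V^{u_k⁻¹·v_k(U′)} = V`» ∧ (H3ˢᵘᵖ), no numeric line (`PairLandauB8EndSfClassFrame`)

Cell `pub-balaban-gaps` (track G2, seat ne3, generation 11), row NE3 of `BALABAN-GAPS.md`; census `HOME/ne/NE3.md` §4 R49, §17.  THE END of record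
`PairLandauB8EndSfClassHP.ne3EnergyRateWCov_sfClass_small_lineFree` (p396369) takes `PairLandauGaugeB8Avg d (sfClass d L N ε) L N b g s₁ s₂ 1 dom` = [Balaban1985RegularSpaces]
Thm 2 WITH (1.37) read at the minimiser pair.  By `PairFrameCondition.pairLandauGaugeB8Avg_iff_frame` (this generation) that hypothesis is EQUIVALENT to the
body `LandauRepB8` of Thm 2 WITHOUT (1.37) at every pair together with the STABILISER CONDITION `V^{g} = V` for the coarse frame gauge `g = u_k⁻¹·v_k(relPert W Z)`
([Balaban1985Averaging] (92)∕(159), (97)); this module re-issues THE END in that displayed form (`ne3EnergyRateWCov_sfClass_small_lineFree_of_frame`) and in the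
sufficient (1.29)-type form `v_k(relPert W Z) = u_k` (`…_of_frame_eq`), so that the row's remaining [B8]-TYPE splits BY NAME into (i) the gauge-existence ∕ regularity body
`LandauRepB8` (whose `rep ∕ landau ∕ sup` members the owner lineage's brick E′ `CurvedLandauRep` constructs from relative data) and (ii) the coarse frame normalisation.

HONEST FRAMING (page 1).  Bookkeeping over landed theorems BY NAME (0 def, 0 sorry): nothing of Bałaban's is asserted or discharged; `LandauRepB8` at the pairs
and the frame condition are HYPOTHESES; the covariant root and **NE3 are NOT proved**; spine PROVED 0∕9; finite T⁴ rung (B)+1 — NOT continuum YM on ℝ⁴, NOT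
infinite volume, NOT mass gap, NOT `BetaPertH`, NOT Clay.  HONEST DEPENDENCY: continuum YM on T⁴ ⇐ BetaPertH ∧ nine spine estimates (0/9 proved); BetaPertH ⇐
(D1) ∧ (D4) ∧ CAP+tail; G-an2-4 gates asym, D1 and NE2/3/4.  PLACEMENT: `Summits/QuantumFields/BalabanUV/T4Continuum/Spine/NE3/`; imports the accepted END
`PairLandauB8EndSfClassHP` and `PairFrameCondition` only.
-/

set_option autoImplicit false

open scoped BigOperators Matrix Matrix.Norms.L2Operator
open NormedSpace

namespace Summit.QuantumFields.BalabanUV.T4Continuum.NE3.PairLandauB8EndSfClassFrame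

open Literature.MathematicalPhysics.QuantumFieldTheory.Balaban1983to89
open B7Prop1Explicit B7Prop2Explicit
open B7AvgGaugeCovariance (uLev)
open B7Eq92Concrete (vcov)
open MinimalActionSandwich (IsMinimiser)
open MinimalActionRate (Regular sfClass)
open BlockAverageCurrent (curConst)
open NE3EnergyWeightedCovShape (NE3EnergyRateWCov)
open NE3RightInverseSupLetters (frameC)
open NE3.PairLandauB8 (LandauRepB8)
open NE3.PairLandauB8Avg (relPert)
open NE3.LeafIndexSockets (LeafH3sup)
open NE3.PairLandauB8EndSfClassHP (ne3EnergyRateWCov_sfClass_small_lineFree)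
open NE3.PairFrameCondition (pairLandauGaugeB8Avg_iff_frame pairLandauGaugeB8Avg_of_frame_eq)

noncomputable section

variable {d : ℕ} {n : Type*} [Fintype n] [DecidableEq n]

/-- **THE END OF RECORD WITH (1.37) DISPLAYED AS THE STABILISER CONDITION** (`3 ≤ d`, `2 ≤ L`, `1 ≤ N`, `g > 0`, `0 ≤ b′, c′`, (Rb), the leaf line on `c′`): there is
`r > 0` such that for all `0 < ε ≤ r`, `0 ≤ s₁ ≤ r`, `0 ≤ b ≤ ε∕2`: «at every pair of `sfClass d L N ε` ∃ `(u, Z)` with `LandauRepB8 L N k W U_A u Z s₁ s₂ 1`,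
`W = rescale L (bavg L U_B)`, AND `V^{u_k⁻¹·v_k(relPert W Z)} = V`» ∧ `LeafH3sup d L N ε b′ c′ dom` ⟹ `∃ C, NE3EnergyRateWCov d (sfClass d L N ε) L N b g C s₁ s₂ dom`
— `ne3EnergyRateWCov_sfClass_small_lineFree` ∘ `pairLandauGaugeB8Avg_iff_frame`. [folklore] -/
theorem ne3EnergyRateWCov_sfClass_small_lineFree_of_frame [Nonempty n] (hd : 3 ≤ d) {L N : ℕ} [NeZero L] [NeZero N] (hL : 2 ≤ L)
    (hN : 1 ≤ N) {g b' c' : ℝ} (hg : 0 < g) (hb' : 0 ≤ b') (hc' : 0 ≤ c')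
    (hRb : 2 ^ 15 * ((d : ℝ) + 1) ^ 2 * ((d : ℝ) + 4) ^ 2 * (L : ℝ) ^ 2 * b' ≤ 1)
    (hcF : 23040 * (d : ℝ) ^ 4 * (frameC d L + d) ^ 3 * (c' + curConst d L * b' ^ 2) ≤ 1) :
    ∃ r : ℝ, 0 < r ∧ ∀ ⦃ε s₁ b : ℝ⦄, 0 < ε → ε ≤ r → 0 ≤ s₁ → s₁ ≤ r → 0 ≤ b → b ≤ ε / 2 →
      ∀ (s₂ : ℝ) {dom : _root_.Set (Site d → Fin d → (Matrix n n ℂ)ˣ)},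
        (∀ k : ℕ, 1 ≤ k → ∀ V ∈ dom, ∀ UA UB : Site d → Fin d → (Matrix n n ℂ)ˣ,
          IsMinimiser d (sfClass d L N ε) L N k V UA → IsMinimiser d (sfClass d L N ε) L N (k + 1) V UB → Regular d L N b g (k + 1) UB →
            ∃ (u : Site d → (Matrix n n ℂ)ˣ) (Z : Site d → Fin d → Matrix n n ℂ),
              LandauRepB8 L N k (rescale L (bavg L UB)) UA u Z s₁ s₂ 1 ∧
                gaugeAct (uLev L u⁻¹ k * vcov L (rescale L (bavg L UB)) (relPert (rescale L (bavg L UB)) Z) k) V = V) →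
        LeafH3sup d L N ε b' c' dom →
        ∃ C : ℝ, NE3EnergyRateWCov d (sfClass d L N ε) L N b g C s₁ s₂ dom := by
  obtain ⟨r, hr, h⟩ := ne3EnergyRateWCov_sfClass_small_lineFree (n := n) hd hL hN hg hb' hc' hRb hcF
  refine ⟨r, hr, fun ε s₁ b hε hεr hs₁ hs₁r hb hbε s₂ dom hpair hleaf => ?_⟩
  exact h hε hεr hs₁ hs₁r hb hbε s₂ (pairLandauGaugeB8Avg_iff_frame.2 hpair) hleaf

/-- **THE END OF RECORD WITH (1.37) IN ITS (1.29)-TYPE SUFFICIENT FORM `v_k(relPert W Z) = u_k`** (the accumulated frame (97) of the perturbation equals the corner values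
of the gauge): same conclusion. [folklore] -/
theorem ne3EnergyRateWCov_sfClass_small_lineFree_of_frame_eq [Nonempty n] (hd : 3 ≤ d) {L N : ℕ} [NeZero L] [NeZero N] (hL : 2 ≤ L)
    (hN : 1 ≤ N) {g b' c' : ℝ} (hg : 0 < g) (hb' : 0 ≤ b') (hc' : 0 ≤ c')
    (hRb : 2 ^ 15 * ((d : ℝ) + 1) ^ 2 * ((d : ℝ) + 4) ^ 2 * (L : ℝ) ^ 2 * b' ≤ 1)
    (hcF : 23040 * (d : ℝ) ^ 4 * (frameC d L + d) ^ 3 * (c' + curConst d L * b' ^ 2) ≤ 1) :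
    ∃ r : ℝ, 0 < r ∧ ∀ ⦃ε s₁ b : ℝ⦄, 0 < ε → ε ≤ r → 0 ≤ s₁ → s₁ ≤ r → 0 ≤ b → b ≤ ε / 2 →
      ∀ (s₂ : ℝ) {dom : _root_.Set (Site d → Fin d → (Matrix n n ℂ)ˣ)},
        (∀ k : ℕ, 1 ≤ k → ∀ V ∈ dom, ∀ UA UB : Site d → Fin d → (Matrix n n ℂ)ˣ,
          IsMinimiser d (sfClass d L N ε) L N k V UA → IsMinimiser d (sfClass d L N ε) L N (k + 1) V UB → Regular d L N b g (k + 1) UB →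
            ∃ (u : Site d → (Matrix n n ℂ)ˣ) (Z : Site d → Fin d → Matrix n n ℂ),
              LandauRepB8 L N k (rescale L (bavg L UB)) UA u Z s₁ s₂ 1 ∧
                vcov L (rescale L (bavg L UB)) (relPert (rescale L (bavg L UB)) Z) k = uLev L u k) →
        LeafH3sup d L N ε b' c' dom →
        ∃ C : ℝ, NE3EnergyRateWCov d (sfClass d L N ε) L N b g C s₁ s₂ dom := by
  obtain ⟨r, hr, h⟩ := ne3EnergyRateWCov_sfClass_small_lineFree (n := n) hd hL hN hg hb' hc' hRb hcF
  refine ⟨r, hr, fun ε s₁ b hε hεr hs₁ hs₁r hb hbε s₂ dom hpair hleaf => ?_⟩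
  exact h hε hεr hs₁ hs₁r hb hbε s₂ (pairLandauGaugeB8Avg_of_frame_eq hpair) hleaf

end

end Summit.QuantumFields.BalabanUV.T4Continuum.NE3.PairLandauB8EndSfClassFrame
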